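import Mathlib
import Literature.Probability.Percolation.KozmaNitzanGoodQuadruple
import HarnessLib

/-!
# `NoHeavyLowerTail` (stmt-CriticalPhenomena-4575), line fat-minority-linear — Kozma–Nitzan's Theorem 5
# WITH THE ANCHOR OF ITS PROOF: Question 9 holds for observers with one private neighbour

Route task `nh-dp-fatminority` (gen 6).  Kozma–Nitzan (arXiv:2401.12397, Thm. 5, p. 13) prove that
`(G, A, 0, b)` is *good* when `0` is isolated in `G ∖ (A ∪ {x})` and `(G ∖ {0}, A, x, b)` is good.  Their
proof (p. 14) in fact establishes the displayed chain
  `P(0 ↔ b) ≥ P(a₀ ↔ b) − Σ_{W ∩ A = ∅} P(C(0) = W) · min_{a∈A} P_{G∖W}(a ↔ b)`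
for `a₀ ∈ A` minimising `P_{G∖{0}}(a ↔ b)` — i.e. goodness with the MAIN TERM AT THE ANCHOR `a₀` of the
deleted graph, which is strictly more than goodness (`min_{a} P(a ↔ b) ≤ P(a₀ ↔ b)`) — before weakening it
to the definition.  We record that intermediate inequality (`thm5_anchor`) and its consequence
(`thm5_anchor_preFKG`): the pre-FKG inequality (41) `P(0 ↔ A, 0 ↮ b) ≤ P(0 ↔ A, a₀ ↮ b)` with the anchor
`a₀ = argmin_A P_H(a ↔ b)`, `H = G` minus the pairs at `0` — Kozma–Nitzan's QUESTION 9 (p. 36) — has a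
positive answer for every observer `0` whose neighbours are relays and at most one further vertex `x` with
`(G∖{0}, A, x, b)` good, in particular (`thm5_anchor_preFKG_star`) one private unit `x` adjacent only to
`A ∪ {0}`.  For the one-layer class of the line this is the tool behind the fixed-anchor certificates of a
glued block with one loose unit ("MONO-FAN": every sub-fan argmin is admissible for the merged star) and
of the rows `B` with anchors `argmin_{Γ'∖(B∖y)}` (`FINDINGS-fat-minority-gen6.md` §1).
The proof is the tree's proof of `KozmaNitzan2024_thm5` (Literature/…/KozmaNitzanGoodQuadruple.lean) with
the anchor exposed as a parameter and the last weakening removed.  No new definitions.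
-/

namespace Summit.CriticalPhenomena.PercolationContinuityZ3.Theorems

open MeasureTheory Set
open Literature.Probability.LatticeModels (prodBernoulli)
open Literature.Probability.Percolation
open Literature.Probability.Percolation.KNGoodAux

noncomputable section
open Classical

variable {V : Type*} [Fintype V]

/-- **Kozma–Nitzan Theorem 5 with the anchor of its proof.**  `0 ∉ A`, `b ≠ 0`, `x ≠ 0`, every pair
`s(0,u)` with `u ∉ A ∪ {x}` null, `(G ∖ {0}, A, x, b)` good, and `a₀ ∈ A` a minimiser over `A` of
`P_{G∖{0}}(a ↔ b)` (`= P(a ↔ b off 0)`).  Then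
`P(a₀ ↔ b) − Σ_{W∩A=∅} P(C(0)=W)·min_{a∈A} P_{G∖W}(a ↔ b) ≤ P(0 ↔ b)`.
[cite: KozmaNitzan2024, proof of Thm. 5 (p. 14, the display before "as needed"); Thm. 5 (p. 13)] -/
theorem thm5_anchor [DecidableEq V] (w : Sym2 V → unitInterval) (A : Finset V) (hA : A.Nonempty)
    (o b x a₀ : V) (hoA : o ∉ A) (hbo : b ≠ o) (hxo : x ≠ o)
    (hiso : ∀ u, u ≠ o → u ∉ A → u ≠ x → w s(o, u) = 0)
    (hgood : KNGood (restrW ({o}ᶜ : Set V) w) A hA x b) (ha₀ : a₀ ∈ A)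
    (hmin : ∀ v ∈ A, (prodBernoulli w).real (openConnIn ({o}ᶜ : Set V) a₀ b) ≤
      (prodBernoulli w).real (openConnIn ({o}ᶜ : Set V) v b)) :
    (prodBernoulli w).real (openConn a₀ b) -
        ∑ W ∈ nullSets A, (prodBernoulli w).real (clusterIs o W) *
          A.inf' hA (fun a => (prodBernoulli w).real (openConnIn ((↑W : Set V)ᶜ) a b)) ≤
      (prodBernoulli w).real (openConn o b) := by
  classical
  set μ := prodBernoulli w with hμ
  set μ' := prodBernoulli (restrW ({o}ᶜ : Set V) w) with hμ'
  -- the correction terms of `G`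
  set c : Finset V → ℝ := fun W => A.inf' hA (fun a => μ.real (openConnIn ((↑W : Set V)ᶜ) a b)) with hc
  set g : Finset V → ℝ := fun W => μ.real (clusterIs o W) * c W with hg
  have hc0 : ∀ W, 0 ≤ c W := fun W => (Finset.le_inf'_iff hA _).2 fun a _ => measureReal_nonneg
  have hg0 : ∀ W, 0 ≤ g W := fun W => mul_nonneg measureReal_nonneg (hc0 W)
  -- `A ∪ {x}` isolates `0`
  set A' : Finset V := insert x A with hA'
  have hoA' : o ∉ A' := by
    rw [hA', Finset.mem_insert]; rintro (h | h); exact hxo h.symm; exact hoA h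
  have hiso' : ∀ u, u ≠ o → u ∉ A' → w s(o, u) = 0 := by
    intro u huo huA'
    rw [hA', Finset.mem_insert, not_or] at huA'
    exact hiso u huo huA'.2 huA'.1
  have ha₀o : a₀ ≠ o := fun h => hoA (h ▸ ha₀)
  have hAo : ∀ a ∈ A, a ≠ o := fun a ha h => hoA (h ▸ ha)
  have hinf' : A.inf' hA (fun a => μ'.real (openConn a b)) = μ.real (openConnIn ({o}ᶜ : Set V) a₀ b) := by
    have h1 : A.inf' hA (fun a => μ'.real (openConn a b)) =
        A.inf' hA (fun a => μ.real (openConnIn ({o}ᶜ : Set V) a b)) :=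
      Finset.inf'_congr hA rfl fun a ha => restrW_real_openConn w o (hAo a ha) b
    rw [h1]
    exact le_antisymm (Finset.inf'_le _ ha₀) ((Finset.le_inf'_iff hA _).2 hmin)
  -- star decompositions over `B ⊆ A ∪ {x}`
  set P := A'.powerset with hP
  have hdec0 : μ.real (openConn o b) = ∑ B ∈ P, μ.real (openConn o b ∩ starEvent o ↑B) :=
    KNPreFKG.real_eq_sum_inter_starEvent w A' o hoA' hiso' (openConn o b)
  have hdec1 : μ.real (openConn a₀ b) = ∑ B ∈ P, μ.real (openConn a₀ b ∩ starEvent o ↑B) :=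
    KNPreFKG.real_eq_sum_inter_starEvent w A' o hoA' hiso' (openConn a₀ b)
  have h0P : (∅ : Finset V) ∈ P := Finset.mem_powerset.2 (Finset.empty_subset _)
  have hxP : ({x} : Finset V) ∈ P.erase ∅ :=
    Finset.mem_erase.2 ⟨Finset.singleton_ne_empty x,
      Finset.mem_powerset.2 (Finset.singleton_subset_iff.2 (Finset.mem_insert_self x A))⟩
  set P2 := (P.erase ∅).erase {x} with hP2
  have hsplit : ∀ f : Finset V → ℝ, ∑ B ∈ P, f B = f ∅ + f {x} + ∑ B ∈ P2, f B := by
    intro f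
    rw [← Finset.add_sum_erase _ _ h0P, ← Finset.add_sum_erase _ _ hxP, add_assoc]
  -- Lemma 5 on the stars meeting `A` ("(15)")
  have hL5 : ∀ B ∈ P2, μ.real (openConn a₀ b ∩ starEvent o ↑B) ≤ μ.real (openConn o b ∩ starEvent o ↑B) := by
    intro B hB
    obtain ⟨hBx, hB'⟩ := Finset.mem_erase.1 hB
    obtain ⟨hBne, hBP⟩ := Finset.mem_erase.1 hB'
    have hBA' : B ⊆ A' := Finset.mem_powerset.1 hBP
    obtain ⟨v, hvB, hvA⟩ : ∃ v ∈ B, v ∈ A := by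
      by_contra hcon
      have hBsub : B ⊆ {x} := fun v hv => by
        have := hBA' hv
        rw [hA', Finset.mem_insert] at this
        rcases this with h | h
        · exact Finset.mem_singleton.2 h
        · exact absurd ⟨v, hv, h⟩ hcon
      rcases Finset.subset_singleton_iff.1 hBsub with h | h
      · exact hBne h
      · exact hBx h
    exact KozmaNitzan2024_lemma5_fintype w o b a₀ v (↑B) ha₀o (hAo v hvA) (Finset.mem_coe.2 hvB) (hmin v hvA)
  -- the star `σ_{x}`
  have hσx : (↑({x} : Finset V) : Set V) = ({x} : Set V) := Finset.coe_singleton x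
  have hdetIn : ∀ y : V, DeterminedBy (openConnIn ({o}ᶜ : Set V) y b : Set (BondConfig V)) (wireSet ({o}ᶜ : Set V)) :=
    fun y => KozmaNitzan.determinedBy_openConnIn_wireSet _ y b subset_rfl
  have hBx0 : μ.real (openConn o b ∩ starEvent o ↑({x} : Finset V)) =
      μ.real (starEvent o ({x} : Set V)) * μ.real (openConnIn ({o}ᶜ : Set V) x b) := by
    rw [hσx, openConn_inter_starEvent_singleton hxo hbo, real_starEvent_inter_of_determinedBy w o {x} (hdetIn x)]
  have hBx1 : μ.real (openConn a₀ b ∩ starEvent o ↑({x} : Finset V)) =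
      μ.real (starEvent o ({x} : Set V)) * μ.real (openConnIn ({o}ᶜ : Set V) a₀ b) := by
    rw [hσx, openConn_inter_starEvent_singleton' ha₀o hbo, real_starEvent_inter_of_determinedBy w o {x} (hdetIn a₀)]
  -- goodness of `(G ∖ {0}, A, x, b)`
  set c' : Finset V → ℝ := fun W => A.inf' hA (fun a => μ'.real (openConnIn ((↑W : Set V)ᶜ) a b)) with hc'
  set CORR' : ℝ := ∑ W ∈ nullSets A, μ'.real (clusterIs x W) * c' W with hCORR'
  have hgood' : μ.real (openConnIn ({o}ᶜ : Set V) a₀ b) - CORR' ≤ μ.real (openConnIn ({o}ᶜ : Set V) x b) := by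
    have h := hgood
    change A.inf' hA (fun a => μ'.real (openConn a b)) - CORR' ≤ μ'.real (openConn x b) at h
    rwa [hinf', restrW_real_openConn w o hxo b] at h
  -- the correction terms of `G ∖ {0}` under `σ_{x}` are correction terms of `G` with `W ∋ 0`, `W ≠ {0}`
  set S' := (nullSets A).filter fun W => o ∉ W ∧ x ∈ W with hS'
  set E' : Finset V → Set (BondConfig V) := fun W => {ω | {y | ω ∈ openConnIn ({o}ᶜ : Set V) x y} = ↑W} with hE'
  have hdetE' : ∀ W, DeterminedBy (E' W) (wireSet ({o}ᶜ : Set V)) := by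
    intro W
    rw [determinedBy_iff]
    intro ω ω' hωω'
    have key : ∀ y, ω ∈ openConnIn ({o}ᶜ : Set V) x y ↔ ω' ∈ openConnIn ({o}ᶜ : Set V) x y := fun y =>
      (determinedBy_iff _ _).1 (KozmaNitzan.determinedBy_openConnIn_wireSet _ x y subset_rfl) ω ω' hωω'
    simp only [hE', mem_setOf_eq]
    rw [show {y | ω ∈ openConnIn ({o}ᶜ : Set V) x y} = {y | ω' ∈ openConnIn ({o}ᶜ : Set V) x y} from
      Set.ext fun y => key y]
  have hc'c : ∀ W, c' W = c (insert o W) := fun W =>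
    Finset.inf'_congr hA rfl fun a ha => restrW_real_openConnIn w o (hAo a ha) b W
  have hclus : ∀ W, μ'.real (clusterIs x W) = μ.real (E' W) := fun W => restrW_real_clusterIs w o hxo W
  have hterm : ∀ W ∈ S', μ.real (starEvent o ({x} : Set V)) * (μ'.real (clusterIs x W) * c' W) ≤ g (insert o W) := by
    intro W _
    rw [hclus, hc'c, ← mul_assoc, ← real_starEvent_inter_of_determinedBy w o {x} (hdetE' W)]
    refine mul_le_mul_of_nonneg_right (measureReal_mono ?_) (hc0 _)
    rintro ω ⟨hσ, hW⟩
    rw [mem_clusterIs, openCluster_eq_of_mem_starEvent_singleton hxo hσ, Finset.coe_insert]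
    simp only [hE', mem_setOf_eq] at hW
    rw [hW]
  have hzero : ∀ W ∈ nullSets A, W ∉ S' → μ.real (starEvent o ({x} : Set V)) * (μ'.real (clusterIs x W) * c' W) = 0 := by
    intro W hW hWS
    have hx : ¬ (o ∉ W ∧ x ∈ W) := fun h => hWS (Finset.mem_filter.2 ⟨hW, h⟩)
    suffices h0 : μ'.real (clusterIs x W) = 0 by rw [h0, zero_mul, mul_zero]
    by_cases hxW : x ∈ W
    · have hoW : o ∈ W := by by_contra h; exact hx ⟨h, hxW⟩
      rw [hclus]
      have : E' W = ∅ := by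
        refine Set.eq_empty_iff_forall_notMem.2 fun ω hω => ?_
        simp only [hE', mem_setOf_eq] at hω
        have : o ∈ {y | ω ∈ openConnIn ({o}ᶜ : Set V) x y} := by rw [hω]; exact Finset.mem_coe.2 hoW
        obtain ⟨_, ho, _⟩ := this
        exact ho rfl
      rw [this, measureReal_empty]
    · rw [clusterIs_eq_empty_of_notMem hxW, measureReal_empty]
  have hinj : Set.InjOn (fun W : Finset V => insert o W) ↑S' := by
    intro W hW W' hW' h
    have hoW : o ∉ W := (Finset.mem_filter.1 (Finset.mem_coe.1 hW)).2.1
    have hoW' : o ∉ W' := (Finset.mem_filter.1 (Finset.mem_coe.1 hW')).2.1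
    have := congrArg (fun s : Finset V => s.erase o) h
    simpa [Finset.erase_insert hoW, Finset.erase_insert hoW'] using this
  have himage : S'.image (fun W => insert o W) ⊆ (nullSets A).erase {o} := by
    intro W hW
    obtain ⟨W', hW', rfl⟩ := Finset.mem_image.1 hW
    obtain ⟨hW'n, hoW', hxW'⟩ := Finset.mem_filter.1 hW'
    refine Finset.mem_erase.2 ⟨fun h => ?_, ?_⟩
    · have : x ∈ ({o} : Finset V) := h ▸ Finset.mem_insert_of_mem hxW'
      exact hxo (Finset.mem_singleton.1 this)
    · rw [mem_nullSets, Finset.disjoint_insert_left]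
      exact ⟨hoA, mem_nullSets.1 hW'n⟩
  have hCORR : μ.real (starEvent o ({x} : Set V)) * CORR' ≤ ∑ W ∈ (nullSets A).erase {o}, g W := by
    calc μ.real (starEvent o ({x} : Set V)) * CORR'
        = ∑ W ∈ nullSets A, μ.real (starEvent o ({x} : Set V)) * (μ'.real (clusterIs x W) * c' W) := by
          rw [hCORR', Finset.mul_sum]
      _ = ∑ W ∈ S', μ.real (starEvent o ({x} : Set V)) * (μ'.real (clusterIs x W) * c' W) :=
          (Finset.sum_subset (Finset.filter_subset _ _) hzero).symm
      _ ≤ ∑ W ∈ S', g (insert o W) := Finset.sum_le_sum hterm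
      _ = ∑ W ∈ S'.image (fun W => insert o W), g W := (Finset.sum_image hinj).symm
      _ ≤ ∑ W ∈ (nullSets A).erase {o}, g W :=
          Finset.sum_le_sum_of_subset_of_nonneg himage fun W _ _ => hg0 W
  -- the `B = ∅` term of `P(a₀ ↔ b)` is the `W = {0}` correction term
  have hW0 : μ.real (openConn a₀ b ∩ starEvent o ↑(∅ : Finset V)) = g {o} := by
    rw [Finset.coe_empty, real_openConn_inter_starEvent_empty w o ha₀o b, hg, hc]
    simp only
    rw [Finset.coe_singleton]
    congr 1
    exact (le_antisymm (Finset.inf'_le (fun a => μ.real (openConnIn ({o}ᶜ : Set V) a b)) ha₀)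
      ((Finset.le_inf'_iff hA (fun a => μ.real (openConnIn ({o}ᶜ : Set V) a b))).2 hmin)).symm
  have hmemW : ({o} : Finset V) ∈ nullSets A := by
    rw [mem_nullSets, Finset.disjoint_singleton_left]; exact hoA
  have hCORRsplit : ∑ W ∈ nullSets A, g W = g {o} + ∑ W ∈ (nullSets A).erase {o}, g W :=
    (Finset.add_sum_erase _ _ hmemW).symm
  -- assemble (as in the source, but WITHOUT the final `min_A P(a ↔ b) ≤ P(a₀ ↔ b)`)
  have hsum2 : ∑ B ∈ P2, μ.real (openConn a₀ b ∩ starEvent o ↑B) ≤ ∑ B ∈ P2, μ.real (openConn o b ∩ starEvent o ↑B) :=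
    Finset.sum_le_sum hL5
  have h00 : 0 ≤ μ.real (openConn o b ∩ starEvent o ↑(∅ : Finset V)) := measureReal_nonneg
  have hσ0 : 0 ≤ μ.real (starEvent o ({x} : Set V)) := measureReal_nonneg
  have hx0 : μ.real (openConn o b ∩ starEvent o ↑({x} : Finset V)) ≥
      μ.real (openConn a₀ b ∩ starEvent o ↑({x} : Finset V)) - μ.real (starEvent o ({x} : Set V)) * CORR' := by
    rw [hBx0, hBx1]
    nlinarith [hgood', hσ0]
  have ha₀dec : μ.real (openConn a₀ b) = g {o} + μ.real (openConn a₀ b ∩ starEvent o ↑({x} : Finset V)) +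
      ∑ B ∈ P2, μ.real (openConn a₀ b ∩ starEvent o ↑B) := by
    rw [hdec1, hsplit, hW0]
  show μ.real (openConn a₀ b) - ∑ W ∈ nullSets A, g W ≤ μ.real (openConn o b)
  rw [hdec0, hsplit, hCORRsplit, ha₀dec]
  linarith [hsum2, h00, hx0, hCORR]

/-- **Question 9 for observers with one private neighbour** (pre-FKG form with the deleted-graph anchor).
Under the hypotheses of `thm5_anchor`:  `P(a₀ ↔ b, 0 ↔ A) ≤ P(0 ↔ b)`, i.e.
`P(0 ↔ A, 0 ↮ b) ≤ P(0 ↔ A, a₀ ↮ b)` for the minimiser `a₀` of `P_{G∖{0}}(· ↔ b)` over `A` — Kozma–Nitzan's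
inequality (41) with the anchor of their Question 9 (the graph `H` of Question 9, `G` minus the pairs at `0`,
has the same `a ↔ b` connections as `G ∖ {0}`).  Derivation as on p. 12 ("a good graph satisfies (2)") with
`a₀` in place of the minimiser of `P(· ↔ b)`:  the correction term is at most
`Σ_W P(C(0)=W) P_{G∖W}(a₀ ↔ b) = P(a₀ ↔ b, 0 ↮ A)`.
[cite: KozmaNitzan2024, Question 9 (p. 36); proof of Thm. 5 (p. 14); §3.2 p. 12] -/
theorem thm5_anchor_preFKG [DecidableEq V] (w : Sym2 V → unitInterval) (A : Finset V) (hA : A.Nonempty)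
    (o b x a₀ : V) (hoA : o ∉ A) (hbo : b ≠ o) (hxo : x ≠ o)
    (hiso : ∀ u, u ≠ o → u ∉ A → u ≠ x → w s(o, u) = 0)
    (hgood : KNGood (restrW ({o}ᶜ : Set V) w) A hA x b) (ha₀ : a₀ ∈ A)
    (hmin : ∀ v ∈ A, (prodBernoulli w).real (openConnIn ({o}ᶜ : Set V) a₀ b) ≤
      (prodBernoulli w).real (openConnIn ({o}ᶜ : Set V) v b)) :
    (prodBernoulli w).real (openConn a₀ b ∩ ⋃ a' ∈ A, openConn o a') ≤
      (prodBernoulli w).real (openConn o b) := by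
  classical
  set μ := prodBernoulli w with hμ
  have h5 := thm5_anchor w A hA o b x a₀ hoA hbo hxo hiso hgood ha₀ hmin
  -- the correction term is at most `P(a₀ ↔ b, 0 ↮ A)`
  have hcorr : ∑ W ∈ nullSets A, μ.real (clusterIs o W) *
        A.inf' hA (fun a => μ.real (openConnIn ((↑W : Set V)ᶜ) a b)) ≤
      μ.real ({ω | ∀ a ∈ A, ¬ (openGraph ω).Reachable o a} ∩ openConn a₀ b) := by
    rw [← sum_real_clusterIs_inter w A o]
    refine Finset.sum_le_sum fun W hW => ?_
    have ha₀W : a₀ ∉ W := fun h' => Finset.disjoint_left.1 (mem_nullSets.1 hW) h' ha₀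
    rw [real_clusterIs_inter_openConn w o W ha₀W b]
    exact mul_le_mul_of_nonneg_left (Finset.inf'_le _ ha₀) measureReal_nonneg
  -- `P(a₀ ↔ b) = P(a₀ ↔ b, 0 ↔ A) + P(a₀ ↔ b, 0 ↮ A)`
  have hsplit : μ.real (openConn a₀ b) = μ.real (openConn a₀ b ∩ ⋃ a' ∈ A, openConn o a') +
      μ.real ({ω | ∀ a ∈ A, ¬ (openGraph ω).Reachable o a} ∩ openConn a₀ b) := by
    rw [inter_comm {ω | ∀ a ∈ A, ¬ (openGraph ω).Reachable o a}, ← measureReal_inter_add_sdiff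
      (s := (openConn a₀ b : Set (BondConfig V)))
      (MeasurableSet.of_discrete : MeasurableSet (⋃ a' ∈ A, (openConn o a' : Set (BondConfig V))))]
    congr 1
    congr 1
    ext ω
    simp only [mem_sdiff, mem_iUnion, exists_prop, not_exists, not_and, mem_inter_iff, mem_setOf_eq]
    exact ⟨fun ⟨h1, h2⟩ => ⟨h1, h2⟩, fun ⟨h1, h2⟩ => ⟨h1, h2⟩⟩
  linarith [hcorr, hsplit, h5]

/-- **One private unit: Question 9 holds** (the configuration of Kozma–Nitzan's example after Thm. 5,
p. 13: "`0` is connected only to `A` and to a certain `x`, which, in turn, is connected only to `A ∪ 0`").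
If `0 ∉ A`, `b ≠ 0`, `x ∉ A`, `x ≠ 0`, the pairs `s(0,u)` (`u ∉ A ∪ {x}`) and `s(x,u)` (`u ∉ A ∪ {0}`) are
null, and `a₀ ∈ A` minimises `P_{G∖{0}}(· ↔ b)` over `A`, then `P(0 ↔ A, 0 ↮ b) ≤ P(0 ↔ A, a₀ ↮ b)`,
stated as `P(a₀ ↔ b, 0 ↔ A) ≤ P(0 ↔ b)`.  (Theorem 4 makes `(G∖{0}, A, x, b)` good; then
`thm5_anchor_preFKG`.)  With `w s(0,x) = 1` the pair `{0,x}` is one glued block with two fans: for the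
line's merged star `Z = x ∪ y` this says that `argmin_A P_{Λ + x}(· ↔ b)` — and, re-splitting the fans,
every sub-fan argmin — is an admissible FIXED anchor ("MONO-FAN", `FINDINGS-fat-minority-gen6.md` §1c).
[cite: KozmaNitzan2024, Thm. 5 and the example after it (p. 13); Question 9 (p. 36)] -/
theorem thm5_anchor_preFKG_star [DecidableEq V] (w : Sym2 V → unitInterval) (A : Finset V)
    (hA : A.Nonempty) (o b x a₀ : V) (hoA : o ∉ A) (hbo : b ≠ o) (hxA : x ∉ A) (hxo : x ≠ o)
    (hiso : ∀ u, u ≠ o → u ∉ A → u ≠ x → w s(o, u) = 0)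
    (hisox : ∀ u, u ≠ x → u ∉ A → u ≠ o → w s(x, u) = 0) (ha₀ : a₀ ∈ A)
    (hmin : ∀ v ∈ A, (prodBernoulli w).real (openConnIn ({o}ᶜ : Set V) a₀ b) ≤
      (prodBernoulli w).real (openConnIn ({o}ᶜ : Set V) v b)) :
    (prodBernoulli w).real (openConn a₀ b ∩ ⋃ a' ∈ A, openConn o a') ≤
      (prodBernoulli w).real (openConn o b) := by
  refine thm5_anchor_preFKG w A hA o b x a₀ hoA hbo hxo hiso ?_ ha₀ hmin
  refine KozmaNitzan2024_thm4_good (restrW ({o}ᶜ : Set V) w) A hA x b hxA fun u hux huA => ?_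
  by_cases huo : u = o
  · subst huo
    exact restrW_apply_of_not_mem w fun h => (mk_mem_wireSet_iff.1 h).2.1 rfl
  · exact le_antisymm ((restrW_le _ w s(x, u)).trans (hisox u hux huA huo).le) bot_le

end

end Summit.CriticalPhenomena.PercolationContinuityZ3.Theorems
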